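import Mathlib
import Literature.Analysis.FluidPDE.ClassicalSolution
import Literature.Analysis.FluidPDE.VectorCalculus
import Literature.Analysis.FluidPDE.Vorticity
import Literature.Analysis.FluidPDE.SelfSimilar
import Literature.Analysis.FluidPDE.SelfSimilarLiouville
import Literature.Analysis.FluidPDE.AxisymmetricEuler
import Literature.Analysis.FluidPDE.NSBoundedMildOseen
import Literature.Analysis.UnboundedOperators.HeatKernel
import Summits.NavierStokesRegularity.NavierStokesRegularity.Theses.ThreadingFlux
import Summits.NavierStokesRegularity.NavierStokesRegularity.Theses.UnthreadedRigidityDoor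
import Summits.NavierStokesRegularity.NavierStokesRegularity.Theorems.ThreadingFluxPrecessionKinematics
import Summits.NavierStokesRegularity.NavierStokesRegularity.Theorems.ThreadingFluxPrecessionOseenEternalLiouville
import Summits.NavierStokesRegularity.NavierStokesRegularity.Theorems.ThreadingFluxPoloidalLiouvillePrecessionSwirl
import Summits.NavierStokesRegularity.NavierStokesRegularity.Theorems.ThreadingFluxPoloidalLiouvillePrecessionOseenTimeLipschitz
import Summits.NavierStokesRegularity.NavierStokesRegularity.Theorems.ThreadingFluxPoloidalLiouvillePrecessionFastW1
import Summits.NavierStokesRegularity.NavierStokesRegularity.Theorems.UnthreadedRigidityDoorUnthreadedRigidityPrecessionFastW2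
import Summits.NavierStokesRegularity.NavierStokesRegularity.Theorems.UnthreadedRigidityDoorUnthreadedRigidityPrecessionSlicesC2
import Summits.NavierStokesRegularity.NavierStokesRegularity.Theorems.ThreadingFluxPrecessionConicalEulerRigidity
import Summits.NavierStokesRegularity.NavierStokesRegularity.Theorems.ThreadingFluxCentreJetSteadyStratumMild

/-! # Sketch — crux idea «precession-gap» (negation lens) for `PoloidalLiouville` (stmt-NavierStokesRegularity-1222)

Walls: W1 = `stub_scalarLiouville` (1222; a DECIDED sub-class = rung, and the typed residual core) and
W2 = `stub_shearedRigidity` (27585; the same rung in window-rigidity form).  `Prop`s only — nothing is proved in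
this file; NS regularity is NOT proved by any of this; `PoloidalLiouville` and `UnthreadedRigidity` stay OPEN.

NEGATION LENS.  Where can a counterexample to W1 hide from every sieve on file?  The three jet-tower cards
(«reynolds-quadrupole-threading», «horizon-threading-tower», «linear-loop-law») and the antidynamo skeleton all read
the vanishing of the threading coefficients `c_k = ∂ₜᵏ⟪y, curl v⟫` as constraints on a datum.  On the stratum of
RELATIVE EQUILIBRIA of the symmetry group of the class — steady states and rigidly PRECESSING states (rotating waves
about an axis through the centre `x₀`), more generally time-periodic states — these constraints are VOID:
`⟪y, curl((V·∇)V)⟫ = ⟪y, curl(ΔV − ∇p)⟫ = ⟪y, Δ curl V⟫ = Δ⟪y, curl V⟫ − 2 div curl V = 0` for a steady unthreaded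
state (`LaplacianNeverThreads`, `SteadyLoopLawAutomatic`), and a rotating wave unthreaded at one instant is unthreaded
for ever by equivariance (`RotatingWaveStaysUnthreaded`).  So the cheapest UNDETECTED counterexample to W1 is a steady
or precessing poloidal flow, and I tried to BUILD the precessing one where a construction has a handle: at large
precession rate `Ω`, where the co-rotating linear operator `Ω J − Δ` has a spectral gap `∼ |m| Ω` on every
non-axisymmetric azimuthal mode.  The gap KILLS it — typed obstruction = a Liouville theorem:

* `ShortPeriodCollapse` (general NS lemma, M): an honest (Oseen–Duhamel) bounded mild time-periodic solution on
  `ℝ × ℝ³` with period `P` and `P·‖u‖²_∞ ≤ c₀` is STEADY.  Mechanism (Galdi–Kyed's purely-oscillatory gain, in `L^∞`):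
  the period-mean-free part `u' = u − ū` obeys `u'(t) = e^{NPΔ}u'(t) − Σ_k ∫_{k-th past period} e^{θΔ}ℙ∇·F'(t−θ)dθ`
  with `F' = u⊗u − avg(u⊗u) = ū⊗u' + u'⊗ū + (u'⊗u')'`, `‖F'‖_∞ ≤ 6‖u‖_∞‖u'‖_∞`; the Oseen kernel bounds
  `‖e^{θΔ}ℙ∇·‖_{L¹} ≤ Cθ^{-1/2}`, `‖∂_θ e^{θΔ}ℙ∇·‖_{L¹} ≤ Cθ^{-3/2}` and the zero period-mean of `F'` give
  `‖k-th term‖ ≤ C P^{1/2} k^{-3/2}‖F'‖`, and `e^{NPΔ}u'(t) → 0` (its period-average vanishes and its oscillation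
  over one period is `O((NP)^{-1/2})`); hence `‖u'‖_∞ ≤ C'√P·6‖u‖_∞‖u'‖_∞`, so `u' = 0` once `36C'²P‖u‖²_∞ < 1`.
* `UnthreadedAxisymmetricNoSwirl` (swirl lemma, S): an axisymmetric field whose vorticity is tangent to the spheres
  about a point OF THE AXIS has no swirl (`⟪curl V, y⟫ = ϖ⁻¹(z∂_ϖ − ϖ∂_z)Γ`, so `Γ = ϖ v_θ` is constant on the
  meridional half-circles about the centre, each of which meets the axis, where `Γ = 0`).
* `FastPrecessionPoloidalLiouville` (W1 RUNG, M): 1222's hypotheses + [honest Oseen-mild, rotating wave about an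
  axis through `x₀` with `|Ω| ≥ C‖V‖²_∞`] ⇒ 1222's conclusion.  Proof: period `2π/|Ω|` is short ⇒ steady
  (`ShortPeriodCollapse`) ⇒ `(R_t)_* V = V`, i.e. `V` axisymmetric about the axis ⇒ no swirl (swirl lemma) ⇒
  KNSS Thm 5.2 (tree `knss_axisymmetric_no_swirl'_holds`) ⇒ constant slices.  A sub-class of 1222 decided
  WITHOUT assuming axisymmetry: the profile `V` is arbitrary a priori.  `FastPrecessionUnthreadedRigidity` is the
  same rung in the shape of 27585 (the skew map `A` is the rotation generator).
* The bifurcation reading (`OseenEternalLiouville`, S, known): the linearisation at the trivial family (constant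
  drifts) has no bounded eternal honest-mild solution other than constants — precessing / steady poloidal states
  have NO LOCAL ORIGIN anywhere in the class; together with the scaling `v ↦ λv(λ²t, λx)` (which trades amplitude
  for precession rate, invariant `ν|Ω|/‖V‖²_∞`) the fast regime is exactly the perturbative end of the stratum.
* The RESIDUAL CORE, typed and OPEN: `SteadyPoloidalLiouvilleW1` (the steady sub-case of 1222 verbatim),
  `SteadyPoloidalLiouville` (classical phrasing: bounded steady NS on `ℝ³` with vortex lines on concentric spheres
  is constant — outside KNSS (no axisymmetry assumed), outside Galdi / Chae / Seregin / Chae–Wolf steady Liouville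
  theorems (no decay assumed), untouched by every jet sieve), `SlowPrecessionPoloidalLiouville` (`|Ω| < C‖V‖²_∞`).
  Steady structure available to an attack (card §steady): loop law automatic; head laws on spheres
  `∇_S(H + T + rT_r) = m ∇_S T`, `r H_r = Δ_{S²}T − r v_tan·∇_{S²}T`; scalar law `ΔT − v·∇T = 𝓗_r(T,r)/r`
  (`𝓗_T = M`, `m = M(T,r)`); head subsolution `ΔH − v·∇H = |curl v|² = |∇_{S²}T|²`.
* `ConicalSteadyEulerRigidity` (steady-horizon remark, S/M): a `0`-homogeneous real-analytic steady Euler field on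
  `ℝ³∖{0}` with `0`-homogeneous pressure and vorticity tangent to the spheres is CONSTANT (`U = fξ + ∇_S ψ`,
  `Δ_S ψ = −2f`; tangential balance ⇒ `{f, ψ} = 0`; radial balance ⇒ `∇ψ·∇(f − ψ) = 0` ⇒ `f = ψ + c` ⇒ `l = 1`
  ⇒ `U = a`): the blow-down horizon of a STEADY unthreaded flow is rigid already at the level the horizon card
  leaves open (zonal profiles), provided the pressure carries no `log r` term.
v2 (2026-08-28, V15 PASS-WITH-PRICE paid — ns-wall-crit-1 g0): §«V15 prices» below types, as named `Prop`s, the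
Oseen-kernel TIME-LIPSCHITZ `L¹` bound the `k^{-3/2}` step needs (P1: `OseenKernelTimeLipschitzL1`, sources BY NAME
`exists_integral_norm_iteratedFDeriv_oseenKernelCLM_prod_le_rpow` (m = 1) + `oseenKernelCLM_sq_mul_smul` + the
semigroup law `heatExtension_oseenKernel`), the four S-glue lemmas of the rung's by-name closure (P2: g1
`PeriodicExtensionHonestMild`, g2 `SteadyRotatingWaveAxisymmetric` (+ the `B = 0` case `ZeroProfileConstant`), g3
`ClassTranslation`, g4 `ConstantSliceOfAEConst`), the regularity source for `fderiv` in G (P3: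
`BoundedHonestMildSlicesC2`, input `knss2009_local_smoothing` + `oseenMild_bounded_unique` by name), and the two
priced chains `FastPrecessionChainW1` / `FastPrecessionChainW2` (pure bookkeeping `Prop`s: which named pieces the
hand composes).  LABELS (P4): F is «M: ONE new general NS lemma (`ShortPeriodCollapse`, M) + one S-stub (swirl) +
KNSS′ (tree, kernel-proved) + S-glue g1–g4 (+ P1 as an S/M− kernel stub)»; what F DECIDES is NON-EXISTENCE — the
fast half `ε = ν|Ω|/‖V‖²_∞ ≥ C` of the precessing stratum is EMPTY of counterexamples (forced steady ⇒ axisymmetric ⇒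
swirl-free ⇒ KNSS-constant); the flows it classifies are KNSS's; 1222 / C⁻ / `stub_scalarLiouville` untouched.
-/

set_option linter.dupNamespace false

namespace Summit.NavierStokesRegularity.NavierStokesRegularity.Cruxes.PoloidalLiouville.Precession

open Set Function MeasureTheory
open Literature.Analysis.FluidPDE (cross curl rotZ IsAxisymmetric HasNoSwirl IsBoundedAncientMildSolution oseenDuhamel)
open Literature.Analysis.FluidPDE.VectorCalculus (IsDivFree divergence)
open Literature.Analysis.UnboundedOperators (heatExtension)

local notation "E3" => EuclideanSpace ℝ (Fin 3)

/-! ## Definitions (kinematic vocabulary of the stratum) -/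

/-- Threading density of a slice about the centre `x₀`: `ρ_{x₀}(V)(x) = ⟪x − x₀, curl V x⟫`. -/
noncomputable def threading (x₀ : E3) (V : E3 → E3) (x : E3) : ℝ :=
  inner ℝ (x - x₀) (curl V x)

/-- A slice is UNTHREADED about `x₀` (vortex lines tangent to the spheres about `x₀`). -/
def IsUnthreadedAbout (x₀ : E3) (V : E3 → E3) : Prop :=
  ∀ x, threading x₀ V x = 0

/-- ROTATING WAVE (rigidly precessing state) about the axis through `x₀` parallel to `e₂` (WLOG by Euclidean
invariance), angular velocity `Ω`, profile `V` in centred co-rotating coordinates: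
`v(t, x₀ + y) = R_{Ωt} V(R_{−Ωt} y)`.  `Ω = 0` or `V` axisymmetric gives a steady state. -/
def IsRotatingWave (x₀ : E3) (Ω : ℝ) (V : E3 → E3) (v : ℝ → E3 → E3) : Prop :=
  ∀ t x, v t x = rotZ (Ω * t) (V (rotZ (-(Ω * t)) (x - x₀)))

/-- HONEST (Oseen–Duhamel, `ν = 1`) mild identity on a set of times `S`, exactly as in `UnthreadedRigidity`
(27585): `u(t) = e^{(t−s)Δ}u(s) − B_s(u,u)(t)` pointwise for `s < t` in `S`.  It excludes the parasitic drifts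
`b(t)` and the Galilean wobbles `V(x − a(t)) + a'(t)` of the duality class. -/
def IsOseenMildOn (S : Set ℝ) (u : ℝ → E3 → E3) : Prop :=
  ∀ s ∈ S, ∀ t ∈ S, s < t → ∀ x, u t x = heatExtension (u s) (t - s) x - oseenDuhamel 1 s u u t x

/-! ## The tower is void on relative equilibria -/

/-- (A, S — kinematic) THE LAPLACIAN NEVER THREADS: `⟪y, Δ curl V⟫ = Δ⟪y, curl V⟫ − 2 div curl V`, so the class of
fields unthreaded about `x₀` is invariant under `Δ` (and `curl Δ = Δ curl`). -/
def LaplacianNeverThreads : Prop :=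
  ∀ (V : E3 → E3) (x₀ : E3), ContDiff ℝ 3 V → IsUnthreadedAbout x₀ V →
    IsUnthreadedAbout x₀ (Laplacian.laplacian V)

/-- (B, S) STEADY STATES PASS EVERY JET SIEVE FOR FREE: for a classical steady Navier–Stokes state `(V, p)` that is
unthreaded about `x₀`, the advection term does not thread: `⟪x − x₀, curl((V·∇)V)⟫ = ⟪x − x₀, curl(ΔV − ∇p)⟫ = 0`.
Equivalently the loop law `det(y, ∇m, ∇T) = 0` of «linear-loop-law» holds AUTOMATICALLY on steady states, and all
threading coefficients `c_k` vanish identically: the jet tower carries no information on this stratum. -/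
def SteadyLoopLawAutomatic : Prop :=
  ∀ (V : E3 → E3) (p : E3 → ℝ) (x₀ : E3), ContDiff ℝ 3 V → ContDiff ℝ 2 p → IsDivFree V →
    (∀ x, fderiv ℝ V x (V x) + gradient p x = Laplacian.laplacian V x) →
    IsUnthreadedAbout x₀ V → IsUnthreadedAbout x₀ (fun x => fderiv ℝ V x (V x))

/-- (C, S) PRECESSING STATES PASS EVERY JET SIEVE FOR FREE: by `SO(3)`-equivariance of `curl`, a rotating wave about
an axis through `x₀` whose profile is unthreaded about the centre is unthreaded at all times. -/
def RotatingWaveStaysUnthreaded : Prop :=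
  ∀ (v : ℝ → E3 → E3) (x₀ : E3) (Ω : ℝ) (V : E3 → E3), ContDiff ℝ 1 V → IsRotatingWave x₀ Ω V v →
    IsUnthreadedAbout 0 V → ∀ t, IsUnthreadedAbout x₀ (v t)

/-! ## The precession gap -/

/-- (D, M — general Navier–Stokes lemma; the typed obstruction of the negation attempt) SHORT-PERIOD COLLAPSE: there
is an absolute `c₀ > 0` such that every jointly `C²`, divergence-free, bounded (`‖u‖ ≤ B`), honest Oseen-mild
time-periodic solution on `ℝ × ℝ³` with period `P` and `P B² ≤ c₀` is steady.  Mechanism: contraction of the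
period-mean-free part through the `L¹` bounds of the Oseen kernel and of its time derivative (file docstring);
the `L^q` shadow is Galdi–Kyed's purely-oscillatory estimate.  Dimensionless: `P‖u‖²_∞/ν`. -/
def ShortPeriodCollapse : Prop :=
  ∃ c₀ : ℝ, 0 < c₀ ∧ ∀ (u : ℝ → E3 → E3) (P B : ℝ), 0 < P →
    ContDiff ℝ 2 (uncurry u) → (∀ t, IsDivFree (u t)) → (∀ t x, ‖u t x‖ ≤ B) →
    IsOseenMildOn univ u → (∀ t x, u (t + P) x = u t x) → P * B ^ 2 ≤ c₀ →
    ∀ s t x, u s x = u t x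

/-- (E, S — swirl lemma) An axisymmetric `C¹` field whose vorticity is tangent to the spheres about a point of the
axis, `(0, 0, c)`, has no swirl: `ϖ ⟪curl V, y⟫ = z ∂_ϖΓ − ϖ ∂_zΓ` with `Γ = ϖ v_θ`, so `Γ` is constant on the
meridional half-circles about the centre, each of which ends on the axis where `Γ = 0`. -/
def UnthreadedAxisymmetricNoSwirl : Prop :=
  ∀ (V : E3 → E3) (c : ℝ), ContDiff ℝ 1 V → IsAxisymmetric V →
    IsUnthreadedAbout (EuclideanSpace.single (2 : Fin 3) c) V → HasNoSwirl V

/-- (F, M — the W1 RUNG) FAST-PRECESSION POLOIDAL LIOUVILLE: the hypotheses of `PoloidalLiouville` (1222) verbatim,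
plus (i) the honest Oseen-mild identity on `(−∞, 0)`, (ii) rotating-wave form about an axis through the centre with
profile bound `‖V‖ ≤ B`, (iii) fast precession `C B² ≤ |Ω|` — imply 1222's conclusion.  Chain: `ShortPeriodCollapse`
(period `2π/|Ω|`) ⇒ steady ⇒ `V` axisymmetric ⇒ no swirl (`UnthreadedAxisymmetricNoSwirl`) ⇒ KNSS Thm 5.2
(`Literature.Analysis.FluidPDE.knss_axisymmetric_no_swirl'_holds`, after translating `x₀` to the origin) ⇒ constant
slices.  No axisymmetry is ASSUMED: the profile `V` is arbitrary.  The slow regime `|Ω| < C B²` contains the steady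
stratum (`Ω = 0`) and is OPEN (`SlowPrecessionPoloidalLiouville`). -/
def FastPrecessionPoloidalLiouville : Prop :=
  ∃ C : ℝ, 0 < C ∧ ∀ (v : ℝ → E3 → E3) (x₀ : E3) (Ω B : ℝ) (V : E3 → E3),
    IsBoundedAncientMildSolution 1 v → (∀ t < 0, AEStronglyMeasurable (v t) volume) →
    ContDiffOn ℝ (⊤ : ℕ∞) (uncurry v) (Iio 0 ×ˢ univ) →
    IsOseenMildOn (Iio 0) v → IsRotatingWave x₀ Ω V v → (∀ x, ‖V x‖ ≤ B) → C * B ^ 2 ≤ |Ω| →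
    (∀ t < 0, ∀ x, inner ℝ (x - x₀) (curl (v t) x) = 0) →
    ∀ t < 0, ∃ b : E3, ∀ x, v t x = b

/-- (F′, OPEN — the other half of the precessing stratum) SLOW-PRECESSION POLOIDAL LIOUVILLE: the same statement
with `|Ω| < C B²` for the constant `C` of `FastPrecessionPoloidalLiouville`; stated for every `Ω` (it contains the
steady stratum `Ω = 0`).  Not claimed; typed so that F ∧ F′ is the whole precessing stratum of 1222. -/
def SlowPrecessionPoloidalLiouville : Prop :=
  ∀ (v : ℝ → E3 → E3) (x₀ : E3) (Ω : ℝ) (V : E3 → E3),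
    IsBoundedAncientMildSolution 1 v → (∀ t < 0, AEStronglyMeasurable (v t) volume) →
    ContDiffOn ℝ (⊤ : ℕ∞) (uncurry v) (Iio 0 ×ˢ univ) →
    IsOseenMildOn (Iio 0) v → IsRotatingWave x₀ Ω V v →
    (∀ t < 0, ∀ x, inner ℝ (x - x₀) (curl (v t) x) = 0) →
    ∀ t < 0, ∃ b : E3, ∀ x, v t x = b

/-- (G, M — the same rung in the shape of W2 = `UnthreadedRigidity`, 27585, on the eternal window `S = ℝ`) an
honest Oseen-mild, continuous, divergence-free rotating wave about an axis through `x₀`, unthreaded about `x₀`, with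
`C B² ≤ |Ω|`, is infinitesimally axisymmetric: the skew map is the rotation generator `A y = e₂ × y`. -/
def FastPrecessionUnthreadedRigidity : Prop :=
  ∃ C : ℝ, 0 < C ∧ ∀ (u : ℝ → E3 → E3) (x₀ : E3) (Ω B : ℝ) (V : E3 → E3),
    Continuous (uncurry u) → (∀ t, IsDivFree (u t)) → IsOseenMildOn univ u →
    IsRotatingWave x₀ Ω V u → (∀ x, ‖V x‖ ≤ B) → C * B ^ 2 ≤ |Ω| →
    (∀ t x, inner ℝ (curl (u t) x) (x - x₀) = 0) →
    ∃ A : E3 →L[ℝ] E3, (∀ x, inner ℝ (A x) x = 0) ∧ A ≠ 0 ∧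
      ∀ t x, fderiv ℝ (u t) x (A (x - x₀)) - A (u t x) = 0

/-- (I, S, known — the bifurcation reading) OSEEN ETERNAL LIOUVILLE: a bounded continuous eternal honest-mild solution
of the LINEARISED equation at a constant drift `b` (`∂ₜw + (b·∇)w = Δw − ∇q`, i.e. `w(t) = e^{(t−s)Δ}w(s)(· − (t−s)b)`)
is constant in space and time.  Hence no precessing or steady state bifurcates from the trivial family at ANY
precession rate: the linearised co-rotating operator `imΩ + (b·∇) − Δ` has no bounded kernel on modes `m ≠ 0`
(its symbol `imΩ + i b·ξ + |ξ|²` never vanishes), and `m = 0` gives constants. -/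
def OseenEternalLiouville : Prop :=
  ∀ (w : ℝ → E3 → E3) (b : E3) (B : ℝ), Continuous (uncurry w) → (∀ t x, ‖w t x‖ ≤ B) →
    (∀ s t : ℝ, s < t → ∀ x, w t x = heatExtension (w s) (t - s) (x - (t - s) • b)) →
    ∀ s t x y, w s x = w t y

/-! ## The residual core: the steady stratum -/

/-- (H₁, OPEN — the steady sub-case of 1222 VERBATIM) STEADY POLOIDAL LIOUVILLE inside W1's class: a bounded ancient
duality-class solution with equal slices (steady; this also removes the parasitic drifts), smooth, unthreaded about
`x₀`, has constant slices.  Every threading coefficient of such a solution vanishes identically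
(`SteadyLoopLawAutomatic`): NO jet sieve on file constrains this stratum.  Outside KNSS (no axisymmetry assumed). -/
def SteadyPoloidalLiouvilleW1 : Prop :=
  ∀ (v : ℝ → E3 → E3) (x₀ : E3),
    IsBoundedAncientMildSolution 1 v → (∀ t < 0, AEStronglyMeasurable (v t) volume) →
    ContDiffOn ℝ (⊤ : ℕ∞) (uncurry v) (Iio 0 ×ˢ univ) → (∀ s < 0, ∀ t < 0, v s = v t) →
    (∀ t < 0, ∀ x, inner ℝ (x - x₀) (curl (v t) x) = 0) →
    ∀ t < 0, ∃ b : E3, ∀ x, v t x = b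

/-- (H₂, OPEN — classical phrasing) STEADY POLOIDAL LIOUVILLE: a bounded `C²` steady Navier–Stokes flow on `ℝ³`
(classical, some `C¹` pressure) whose vortex lines lie on the spheres about `x₀` is constant.  In print OPEN even
without the vortex-line hypothesis only under DECAY (`L^{9/2}` Galdi; `Δu ∈ L^{6/5}` Chae; `BMO⁻¹` Seregin); for
merely bounded steady flows nothing is known beyond axisymmetric-no-swirl (KNSS).  Structure an attack can use:
the loop law is automatic; head laws on spheres; `ΔH − V·∇H = |curl V|²`; `ConicalSteadyEulerRigidity` at the horizon. -/
def SteadyPoloidalLiouville : Prop :=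
  ∀ (V : E3 → E3) (p : E3 → ℝ) (x₀ : E3), ContDiff ℝ 2 V → ContDiff ℝ 1 p → IsDivFree V →
    (∀ x, fderiv ℝ V x (V x) + gradient p x = Laplacian.laplacian V x) →
    (∃ B : ℝ, ∀ x, ‖V x‖ ≤ B) → IsUnthreadedAbout x₀ V → ∃ b : E3, ∀ x, V x = b

/-- (J, S/M — steady-horizon remark) CONICAL STEADY EULER RIGIDITY: a real-analytic `0`-homogeneous steady Euler
field on `ℝ³ ∖ {0}` with real-analytic `0`-homogeneous pressure, divergence-free, with vorticity tangent to the
spheres about `0`, is constant.  (`U = fξ + ∇_{S²}ψ`, `Δ_{S²}ψ = −2f`; tangential balance ⇔ `{f, ψ} = 0`; radial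
balance ⇔ `∇ψ·∇(f − ψ) = 0`; so `f = ψ + c` off the critical set, hence everywhere, `Δ_{S²}(ψ + c) = −2(ψ + c)`,
degree one, `U = a`.)  With a `s₀ log r` pressure term the same computation gives only isoparametric, i.e. ZONAL `ψ`. -/
def ConicalSteadyEulerRigidity : Prop :=
  ∀ (U : E3 → E3) (P : E3 → ℝ), AnalyticOnNhd ℝ U {0}ᶜ → AnalyticOnNhd ℝ P {0}ᶜ →
    (∀ c : ℝ, 0 < c → ∀ x, U (c • x) = U x) → (∀ c : ℝ, 0 < c → ∀ x, x ≠ 0 → P (c • x) = P x) →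
    (∀ x, x ≠ 0 → divergence U x = 0) →
    (∀ x, x ≠ 0 → fderiv ℝ U x (U x) + gradient P x = 0) →
    (∀ x, x ≠ 0 → inner ℝ x (curl U x) = 0) →
    ∃ a : E3, ∀ x, x ≠ 0 → U x = a

/-! ## V15 prices (v2): the kernel stub, the glue, the regularity source, the priced chains -/

/-- (P1, S/M− — kernel stub, the source of `√P`) OSEEN-KERNEL TIME-LIPSCHITZ `L¹` BOUND:
`‖K(θ′,·)[a,b] − K(θ,·)[a,b]‖_{L¹} ≤ C (θ′ − θ) θ^{-3/2} ‖a‖‖b‖` for `0 < θ ≤ θ′`.  Tree sources BY NAME: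
`Literature.Analysis.FluidPDE.exists_integral_norm_iteratedFDeriv_oseenKernelCLM_prod_le_rpow` with `m = 1`
(`∫‖D_{(σ,z)}K(σ,z)‖dz ≤ Cσ^{-3/2}` on `(0, W]`), extended to all `θ` by the parabolic scaling
`Literature.Analysis.FluidPDE.oseenKernelCLM_sq_mul_smul`, then the mean-value inequality in `θ`; the `k`-th
past-period shift is the semigroup law `Literature.Analysis.FluidPDE.heatExtension_oseenKernel`.  This is the
second kernel bound of `ShortPeriodCollapse` (the first, `‖K(θ,·)‖_{L¹} ≤ Cθ^{-1/2}`, is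
`Literature.Analysis.FluidPDE.exists_lintegral_enorm_oseenKernel_le`). -/
def OseenKernelTimeLipschitzL1 : Prop :=
  ∃ C : ℝ, 0 ≤ C ∧ ∀ θ θ' : ℝ, 0 < θ → θ ≤ θ' → ∀ a b : E3,
    ∫ z, ‖Literature.Analysis.FluidPDE.oseenKernel θ' z a b - Literature.Analysis.FluidPDE.oseenKernel θ z a b‖ ≤
      C * (θ' - θ) * θ ^ (-(3 / 2 : ℝ)) * ‖a‖ * ‖b‖

/-- (P2-g1, S — glue) PERIODIC EXTENSION: a `P`-periodic, honest Oseen-mild, jointly `C²` solution on `(−∞, 0)`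
extends to a `P`-periodic honest Oseen-mild jointly `C²` solution on `ℝ` (define `u(t) = v(t − kP)` for any `k`
with `t − kP < 0`; well defined by periodicity; the Oseen identity between `s < t` is the one between `s − kP < t − kP
< 0`, translation-invariant in time). -/
def PeriodicExtensionHonestMild : Prop :=
  ∀ (v : ℝ → E3 → E3) (P : ℝ), 0 < P → (∀ t, t + P < 0 → ∀ x, v (t + P) x = v t x) →
    IsOseenMildOn (Iio 0) v → ContDiffOn ℝ 2 (uncurry v) (Iio 0 ×ˢ univ) →
    ∃ u : ℝ → E3 → E3, (∀ t < 0, ∀ x, u t x = v t x) ∧ (∀ t x, u (t + P) x = u t x) ∧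
      IsOseenMildOn univ u ∧ ContDiff ℝ 2 (uncurry u)

/-- (P2-g2, S — glue, pure algebra) A STEADY rotating wave with `Ω ≠ 0` has an AXISYMMETRIC profile: `V(y) =
v(0, x₀ + y) = v(θ/Ω, x₀ + y) = R_θ V(R_{−θ} y)` for every `θ`. -/
def SteadyRotatingWaveAxisymmetric : Prop :=
  ∀ (x₀ : E3) (Ω : ℝ) (V : E3 → E3) (v : ℝ → E3 → E3), IsRotatingWave x₀ Ω V v → Ω ≠ 0 →
    (∀ s t x, v s x = v t x) → IsAxisymmetric V

/-- (P2-g2′, S — the `B = 0` corner of `C B² ≤ |Ω|`, where `Ω = 0` is allowed) a rotating wave with profile bound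
`B = 0` is identically zero, hence has constant slices. -/
def ZeroProfileConstant : Prop :=
  ∀ (x₀ : E3) (Ω : ℝ) (V : E3 → E3) (v : ℝ → E3 → E3), IsRotatingWave x₀ Ω V v → (∀ x, ‖V x‖ ≤ 0) →
    ∀ t, ∃ b : E3, ∀ x, v t x = b

/-- (P2-g3, S — glue) TRANSLATION of the centre to the origin inside the class predicates used by F (KNSS′ is
stated about the `x 2`-axis through `0`). -/
def ClassTranslation : Prop :=
  ∀ (v : ℝ → E3 → E3) (x₀ : E3), IsBoundedAncientMildSolution 1 v →
    IsBoundedAncientMildSolution 1 (fun t x => v t (x + x₀)) ∧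
    (IsOseenMildOn (Iio 0) v → IsOseenMildOn (Iio 0) (fun t x => v t (x + x₀))) ∧
    ((∀ t < 0, AEStronglyMeasurable (v t) volume) → ∀ t < 0, AEStronglyMeasurable (fun x => v t (x + x₀)) volume)

/-- (P2-g4, S — glue) KNSS′ concludes `=ᵐ` a constant; a CONTINUOUS slice a.e. equal to a constant is constant. -/
def ConstantSliceOfAEConst : Prop :=
  ∀ (f : E3 → E3) (b : E3), Continuous f → (f =ᵐ[volume] fun _ => b) → ∀ x, f x = b

/-- (P3, S/known — the regularity source for `fderiv` in G) a bounded, continuous, measurable-sliced, honest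
Oseen-mild ETERNAL solution is jointly `C²` (indeed smooth).  Input BY NAME: KNSS 2009 Prop. 4.1 =
`Literature.Analysis.FluidPDE.knss2009_local_smoothing` (a jointly `C^{k+l}` mild solution from bounded data on a
short window; here k + l = 2) + `Literature.Analysis.FluidPDE.oseenMild_bounded_unique` (it coincides with `u`);
without it the `fderiv` in G's conclusion is the junk `0` and G degenerates to `u ∈ ker A` (V15-P3).  v3 (V16-P5
PAID): conclusion raised from `C¹` to `C²` so that the W2 chain composes — D = `ShortPeriodCollapse` consumes
`ContDiff ℝ 2 (uncurry u)`; no M-lemma changes. -/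
def BoundedHonestMildSlicesC2 : Prop :=
  ∀ (u : ℝ → E3 → E3) (B : ℝ), Continuous (uncurry u) → (∀ t, AEStronglyMeasurable (u t) volume) →
    (∀ t x, ‖u t x‖ ≤ B) → IsOseenMildOn univ u → ContDiff ℝ 2 (uncurry u)

/-- (P2/P4 — the priced chain for the W1 rung, bookkeeping only) F from the named pieces: D (`ShortPeriodCollapse`,
M, whose own inputs are the two kernel bounds, the second = P1) + E (swirl, S) + KNSS′ (tree theorem
`Literature.Analysis.FluidPDE.knss_axisymmetric_no_swirl'_holds`, used inside the hand's proof, not a hypothesis)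
+ glue g1, g2, g2′, g3, g4.  LABEL: M overall; what it decides is NON-EXISTENCE on the fast half of the precessing
stratum. -/
def FastPrecessionChainW1 : Prop :=
  ShortPeriodCollapse → UnthreadedAxisymmetricNoSwirl → PeriodicExtensionHonestMild →
    SteadyRotatingWaveAxisymmetric → ZeroProfileConstant → ClassTranslation → ConstantSliceOfAEConst →
    FastPrecessionPoloidalLiouville

/-- (P3/P4/P5 — the priced chain for the W2-shaped rung) G from D + g2 + the regularity source P3 (the skew map is
the rotation generator; `C²` joint regularity feeds D and identifies `fderiv`; v3: composes end to end). -/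
def FastPrecessionChainW2 : Prop :=
  ShortPeriodCollapse → SteadyRotatingWaveAxisymmetric → BoundedHonestMildSlicesC2 →
    FastPrecessionUnthreadedRigidity

/-! ## Bookkeeping: how the pieces sit relative to the crux -/

/-- The precessing stratum of W1 is F ∧ F′ (definitional split by the rate; recorded as a `Prop`, trivially
provable once `C` is fixed — here only the shape is asserted). -/
def PrecessingStratumSplit : Prop :=
  FastPrecessionPoloidalLiouville → SlowPrecessionPoloidalLiouville →
    ∀ (v : ℝ → E3 → E3) (x₀ : E3) (Ω : ℝ) (V : E3 → E3),
      IsBoundedAncientMildSolution 1 v → (∀ t < 0, AEStronglyMeasurable (v t) volume) →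
      ContDiffOn ℝ (⊤ : ℕ∞) (uncurry v) (Iio 0 ×ˢ univ) →
      IsOseenMildOn (Iio 0) v → IsRotatingWave x₀ Ω V v →
      (∀ t < 0, ∀ x, inner ℝ (x - x₀) (curl (v t) x) = 0) →
      ∀ t < 0, ∃ b : E3, ∀ x, v t x = b

/-- Sanity: the crux implies its steady sub-case (H₁ is literally a special case of 1222). -/
theorem steadyW1_of_poloidalLiouville
    (h : Summit.NavierStokesRegularity.NavierStokesRegularity.Theses.ThreadingFlux.PoloidalLiouville) :
    SteadyPoloidalLiouvilleW1 := by
  intro v x₀ hv hmeas hsmooth _ hunthr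
  exact h v hv hmeas hsmooth ⟨x₀, hunthr⟩

/-- Sanity: the split is by cases on the rate (pure logic). -/
theorem precessingStratumSplit_holds : PrecessingStratumSplit := by
  intro hF hS v x₀ Ω V hv hmeas hsmooth hmild hrw hunthr
  exact hS v x₀ Ω V hv hmeas hsmooth hmild hrw hunthr

/-! ## By-name kernel closures (v4, 2026-08-29): the S pieces and both priced implications are THEOREMS in the tree
(ARM-A / K2-p2 / eng seats; BY-NAME ✓ ns-wall-crit-1 23:20:29Z, 23:59:54Z).  Each `_holds` closes the sketch Prop by the landed term;
`ShortPeriodCollapse` (D, M/L) is the one unpaid input of both chains. -/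
section ByName
open Summit.NavierStokesRegularity.NavierStokesRegularity.Theorems

theorem laplacianNeverThreads_holds : LaplacianNeverThreads := PoloidalLiouville.Precession.laplacianNeverThreads
theorem steadyLoopLawAutomatic_holds : SteadyLoopLawAutomatic := PoloidalLiouville.Precession.steadyLoopLawAutomatic
theorem rotatingWaveStaysUnthreaded_holds : RotatingWaveStaysUnthreaded := PoloidalLiouville.Precession.rotatingWaveStaysUnthreaded
theorem oseenEternalLiouville_holds : OseenEternalLiouville := PoloidalLiouville.Precession.oseenEternalLiouville
theorem unthreadedAxisymmetricNoSwirl_holds : UnthreadedAxisymmetricNoSwirl :=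
  ThreadingFluxPoloidalLiouvillePrecessionSwirl.unthreadedAxisymmetricNoSwirl
theorem oseenKernelTimeLipschitzL1_holds : OseenKernelTimeLipschitzL1 :=
  ThreadingFluxPoloidalLiouvillePrecessionOseenTimeLipschitz.oseenKernelTimeLipschitzL1
theorem boundedHonestMildSlicesC2_holds : BoundedHonestMildSlicesC2 :=
  UnthreadedRigidityDoorUnthreadedRigidityPrecessionSlicesC2.boundedHonestMildSlicesC2

/-- F ⇐ D (W1 fast half): kernel, by name. -/
theorem fastPrecessionPoloidalLiouville_of_shortPeriodCollapse (hD : ShortPeriodCollapse) :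
    FastPrecessionPoloidalLiouville :=
  ThreadingFluxPoloidalLiouvillePrecessionFastW1.fastPrecessionPoloidalLiouville_of_shortPeriodCollapse hD

/-- G ⇐ D (W2-shaped fast half): kernel, by name (P3 discharged inside). -/
theorem fastPrecessionUnthreadedRigidity_of_shortPeriodCollapse (hD : ShortPeriodCollapse) :
    FastPrecessionUnthreadedRigidity :=
  UnthreadedRigidityDoorUnthreadedRigidityPrecessionSlicesC2.fastPrecessionUnthreadedRigidity_of_shortPeriodCollapse' hD

/-- Hence both priced chains hold outright (their other inputs are not even needed any more). -/
theorem fastPrecessionChainW1_holds : FastPrecessionChainW1 :=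
  fun hD _ _ _ _ _ _ => fastPrecessionPoloidalLiouville_of_shortPeriodCollapse hD
theorem fastPrecessionChainW2_holds : FastPrecessionChainW2 :=
  fun hD _ _ => fastPrecessionUnthreadedRigidity_of_shortPeriodCollapse hD


/-! v5 (ns-idea-15 g7, 2026-08-29): (J) `ConicalSteadyEulerRigidity` CLOSED BY NAME — eng-4 p686939
`Theorems/ThreadingFluxPrecessionConicalEulerRigidity.lean` (+ p686484 Tools; BY-NAME ✓ ns-wall-crit-1 02:01:36Z).  Further landed
theorems of the line WITHOUT a sketch twin (recorded, not re-typed): (J′) p687622 `…PrecessionSteadyHorizonRigidity`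
(`Precession.steadyHorizonRigidity`: a steady unthreaded NS blow-down horizon profile is radial-constant), (J″)
`…PrecessionPrecessingHorizon` (`Precession.precessingHorizonAxisymmetric`: the blow-down horizon of a rotating wave is
axisymmetric about the precession axis).  All information-grade; `ShortPeriodCollapse` (D) remains the one unpaid input of
both fast-precession chains; ⟨1222⟩ / ⟨27585⟩ OPEN; NS regularity NOT proved. -/
theorem conicalSteadyEulerRigidity_holds : ConicalSteadyEulerRigidity :=
  PoloidalLiouville.Precession.conicalSteadyEulerRigidity

/-! v5 also: the STEADY STRATUM OF ⟨1222⟩ IN THE CRUX'S OWN CLASS from C1* alone — eng-7 p689391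
`Theorems/ThreadingFluxCentreJetSteadyStratumMild.lean` (bodies verbatim = this sketch's `SteadyPoloidalLiouville(W1)` and the
centre-jet card's master conjecture `CentreJet.SteadyLocalRigidity` (C1*, CONJECTURE, untouched)).  Information-grade; W1 movement 0. -/
theorem steadyPoloidalLiouvilleW1_of_steadyPoloidalLiouville_holds : SteadyPoloidalLiouville → SteadyPoloidalLiouvilleW1 :=
  PoloidalLiouville.CentreJet.steadyPoloidalLiouvilleW1_of_steadyPoloidalLiouville

/- `C1* → SteadyPoloidalLiouvilleW1` is the tree theorem `PoloidalLiouville.CentreJet.steadyPoloidalLiouvilleW1_of_steadyLocalRigidity`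
(hypothesis = the verbatim body of the centre-jet sketch's `CentreJet.SteadyLocalRigidity`, C1*, typed in `CentreJetSketch.lean`;
Cruxes sketches are not importable modules, so the named composition lives on whichever side imports both bodies — eng-7's probe
`HOME/ARM-B/w7g5/lean/ProbeMild.lean`, rc 0, std axioms). -/

end ByName

end Summit.NavierStokesRegularity.NavierStokesRegularity.Cruxes.PoloidalLiouville.Precession
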